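import Mathlib
import HarnessLib

/-!
# LatticeQCDFlow / Scaling — strict Karlin–Rubin: a strictly TP₂ kernel has STRICTLY increasing
# conditional tails

HONEST FRAMING: exact (Metropolis-corrected) sampling algorithms for lattice gauge theory;
figures of merit are autocorrelation/cost numbers at stated couplings and volumes; no
continuum-physics claim.

Venture `LatticeQCDFlow` (cell pub-lqcd), topic `Scaling`, FANOUT row 30 (lean-1, GEN-17) — OUR WORK, the
strict companion of `Scaling/AutoregressiveMonotoneContext` §1 (`tp2_tail_cross_le`,
`tp2_condTail_mono`: TP₂ ⇒ conditional tails non-decreasing), kept free of lattice imports so that it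
lands independently of the build lane:

* **`tp2_tail_cross_lt`** — `K` TP₂ and STRICTLY TP₂ (`u < u'`, `t < t'` ⇒
  `K u t'·K u' t < K u t·K u' t'`), integrable sections, a threshold `c` splitting the reference measure
  (`μ{u > c} > 0` and `μ{u ≤ c} > 0`), `t < t'` ⇒
  `(∫_{u>c} K(u,t))·(∫ K(v,t')) < (∫_{u>c} K(u,t'))·(∫ K(v,t))` (the cross term is the integral over
  `{u > c} × {v ≤ c}` of a function that is positive there).
* **`tp2_condTail_strictMono`** — with positive normalisers: `∫_{u>c}K(u,t)/∫K(u,t)` is STRICTLY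
  increasing in `t` (strict first-order stochastic monotonicity of the conditional laws).

Used by `Scaling/AutoregressiveMonotoneContextStrict` (the exact autoregressive conditional law of a
strictly TP₂ ferromagnet is strictly increasing in every fill-neighbour).  Literature grade (cell rule):
known mechanism (Karlin–Rubin 1956 / Karlin 1968 for the non-strict form) — the strict bookkeeping is
ours and elementary; nothing is cited as a fact; no `def`; no `sorry`.
-/

noncomputable section

namespace Summit.Ventures.LatticeQCDFlow.Theory2.Autoregressive

open MeasureTheory Function Set

variable {X : Type*} [LinearOrder X] [MeasurableSpace X]

/-- **Strict cross inequality for tails of a strictly TP₂ kernel** (strict Karlin–Rubin): `K` TP₂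
and STRICTLY TP₂ (`u < u'`, `t < t'` ⇒ `K u t'·K u' t < K u t·K u' t'`) with integrable sections,
the threshold `c` splitting `μ` (`μ{u > c} > 0`, `μ{u ≤ c} > 0`), `t < t'` ⇒
`(∫_{u>c} K(u,t))·(∫ K(v,t')) < (∫_{u>c} K(u,t'))·(∫ K(v,t))`. [ours] -/
theorem tp2_tail_cross_lt (μ : Measure X) [SFinite μ] (K : X → X → ℝ)
    (hK : ∀ u u' t t', u ≤ u' → t ≤ t' → K u t' * K u' t ≤ K u t * K u' t')
    (hKs : ∀ u u' t t', u < u' → t < t' → K u t' * K u' t < K u t * K u' t')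
    (hint : ∀ t, Integrable (fun u => K u t) μ) {c : X} (hc : MeasurableSet {u | c < u})
    (hA : 0 < μ {u | c < u}) (hAc : 0 < μ {u | c < u}ᶜ) {t t' : X} (htt : t < t') :
    (∫ u in {u | c < u}, K u t ∂μ) * (∫ v, K v t' ∂μ) <
      (∫ u in {u | c < u}, K u t' ∂μ) * (∫ v, K v t ∂μ) := by
  set A : Set X := {u | c < u} with hA'
  have htail : ∀ r, ∫ u in A, K u r ∂μ = ∫ u, A.indicator (fun u => K u r) u ∂μ := fun r =>
    (integral_indicator hc).symm
  have hsplit : ∀ r, ∫ v, K v r ∂μ =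
      (∫ v, A.indicator (fun v => K v r) v ∂μ) + ∫ v, Aᶜ.indicator (fun v => K v r) v ∂μ := by
    intro r
    rw [← integral_add ((hint r).indicator hc) ((hint r).indicator hc.compl)]
    refine integral_congr_ae (ae_of_all _ fun v => ?_)
    by_cases hv : v ∈ A
    · simp [Set.indicator_of_mem hv, Set.indicator_of_notMem (Set.notMem_compl_iff.2 hv)]
    · simp [Set.indicator_of_notMem hv, Set.indicator_of_mem (Set.mem_compl hv)]
  rw [htail, htail, hsplit t', hsplit t, mul_add, mul_add]
  have hcomm : (∫ u, A.indicator (fun u => K u t) u ∂μ) * (∫ v, A.indicator (fun v => K v t') v ∂μ) =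
      (∫ u, A.indicator (fun u => K u t') u ∂μ) * (∫ v, A.indicator (fun v => K v t) v ∂μ) :=
    mul_comm _ _
  -- the cross terms differ by the integral of a function positive on `A × Aᶜ`
  set g : X × X → ℝ := fun p =>
    A.indicator (fun u => K u t') p.1 * Aᶜ.indicator (fun v => K v t) p.2 -
      A.indicator (fun u => K u t) p.1 * Aᶜ.indicator (fun v => K v t') p.2 with hg
  have i1 : Integrable (fun p : X × X =>
      A.indicator (fun u => K u t') p.1 * Aᶜ.indicator (fun v => K v t) p.2) (μ.prod μ) :=
    ((hint t').indicator hc).mul_prod ((hint t).indicator hc.compl)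
  have i2 : Integrable (fun p : X × X =>
      A.indicator (fun u => K u t) p.1 * Aᶜ.indicator (fun v => K v t') p.2) (μ.prod μ) :=
    ((hint t).indicator hc).mul_prod ((hint t').indicator hc.compl)
  have hg0 : ∀ p, 0 ≤ g p := by
    intro p
    simp only [hg]
    by_cases h1 : p.1 ∈ A
    · by_cases h2 : p.2 ∈ Aᶜ
      · simp only [Set.indicator_of_mem h1, Set.indicator_of_mem h2]
        have hle : p.2 ≤ p.1 := (le_of_not_gt (fun h => h2 h)).trans (le_of_lt h1)
        have := hK p.2 p.1 t t' hle htt.le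
        nlinarith [this, mul_comm (K p.1 t) (K p.2 t'), mul_comm (K p.1 t') (K p.2 t)]
      · simp [Set.indicator_of_notMem h2]
    · simp [Set.indicator_of_notMem h1]
  have hgpos : ∀ p : X × X, p.1 ∈ A → p.2 ∈ Aᶜ → 0 < g p := by
    intro p h1 h2
    simp only [hg, Set.indicator_of_mem h1, Set.indicator_of_mem h2]
    have hlt : p.2 < p.1 := lt_of_le_of_lt (le_of_not_gt (fun h => h2 h)) h1
    have := hKs p.2 p.1 t t' hlt htt
    nlinarith [this, mul_comm (K p.1 t) (K p.2 t'), mul_comm (K p.1 t') (K p.2 t)]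
  have hint_g : 0 < ∫ p, g p ∂(μ.prod μ) := by
    rw [integral_pos_iff_support_of_nonneg (fun p => hg0 p) (by rw [hg]; exact i1.sub i2)]
    have hsub : A ×ˢ Aᶜ ⊆ Function.support g := fun p hp => (hgpos p hp.1 hp.2).ne'
    refine lt_of_lt_of_le ?_ (measure_mono hsub)
    rw [Measure.prod_prod]
    exact ENNReal.mul_pos hA.ne' hAc.ne'
  have hdiff : ∫ p, g p ∂(μ.prod μ) =
      (∫ u, A.indicator (fun u => K u t') u ∂μ) * (∫ v, Aᶜ.indicator (fun v => K v t) v ∂μ) -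
        (∫ u, A.indicator (fun u => K u t) u ∂μ) * (∫ v, Aᶜ.indicator (fun v => K v t') v ∂μ) := by
    simp only [hg]
    rw [integral_sub i1 i2, integral_prod_mul (μ := μ) (ν := μ), integral_prod_mul (μ := μ) (ν := μ)]
  linarith [hcomm, hint_g, hdiff]

/-- **Strictly monotone conditional tails**: under the hypotheses of `tp2_tail_cross_lt` with positive
normalisers, `t < t'` ⇒ `∫_{u>c}K(u,t)/∫K(u,t) < ∫_{u>c}K(u,t')/∫K(u,t')`. [ours] -/
theorem tp2_condTail_strictMono (μ : Measure X) [SFinite μ] (K : X → X → ℝ)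
    (hK : ∀ u u' t t', u ≤ u' → t ≤ t' → K u t' * K u' t ≤ K u t * K u' t')
    (hKs : ∀ u u' t t', u < u' → t < t' → K u t' * K u' t < K u t * K u' t')
    (hint : ∀ t, Integrable (fun u => K u t) μ) (hpos : ∀ t, 0 < ∫ u, K u t ∂μ) {c : X}
    (hc : MeasurableSet {u | c < u}) (hA : 0 < μ {u | c < u}) (hAc : 0 < μ {u | c < u}ᶜ)
    {t t' : X} (htt : t < t') :
    (∫ u in {u | c < u}, K u t ∂μ) / (∫ u, K u t ∂μ) <
      (∫ u in {u | c < u}, K u t' ∂μ) / (∫ u, K u t' ∂μ) := by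
  rw [div_lt_div_iff₀ (hpos t) (hpos t')]
  exact tp2_tail_cross_lt μ K hK hKs hint hc hA hAc htt

end Summit.Ventures.LatticeQCDFlow.Theory2.Autoregressive

end
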